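import Summits.RiemannHypothesis.RiemannHypothesis.Theorems.SoloInformedRigidityMoment
import Summits.RiemannHypothesis.RiemannHypothesis.Theorems.SoloInformedMangoldtSums
import Summits.RiemannHypothesis.RiemannHypothesis.Theorems.SoloInformedSimpleZerosLaw
import Literature.NumberTheory.LFunctions.ZeroPairExchange
import Literature.NumberTheory.LFunctions.ZetaArgVariation
import Literature.NumberTheory.Sieve.BrunTwinPrimes
import HarnessLib

/-!
# RH ⟹ windowed anticlustering of the zeros (AC*) (T72i, soloist)

Sorry-free.  The parameter choice closing Lemma 2k.E of the soloist's `paper/sharpest.md`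
§2k (xi): from the second-moment inequality `rigidity_window_moment` (T72h) with `a = 1`,
`A = t`, `N = ⌊√V⌋`, `b = log(N+1)/2` (so `2b = log(N+1)`, `b ≥ log V / 4`, `N² ≤ V`),
`J = ⌊bV⌋`, the Riemann–von Mangoldt lower count `N(t+J/b) − N(t) ≥ V log t/(16π)`
(`exists_zetaZeroCount_window_ge`) and the Chebyshev bound `Σ_{n≤N} Λ(n)²/n ≤ 33 log²t`
(`sum_vonMangoldt_sq_div_le`), one gets `≥ c V log V` cells of length `1/b` in `[t, t+V]` on which
`N` jumps; under RH each holds an ordinate of a zero on the critical line, and the cells of one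
parity give ordinates pairwise `≥ 1/b ≥ e^{−V}` apart.

**Theorem** (`anticlustering_of_riemannHypothesis`).  Assume RH, and let `Φ` be a Weil test with
`supp Φ ⊆ [−1, 1]` and `|Φ̂(1/2 + iu)|² ≥ μ > 0` for `|u| ≤ 2`.  Then there are `c > 0` and `t*`
such that every window `[t, t + V]` with `t ≥ t*`, `log t ≤ V ≤ t` contains a set `S` of
ordinates `γ` of zeros `ζ(1/2 + iγ) = 0`, pairwise `≥ e^{−V}` apart, with `#S ≥ c V log V`.

This is exactly hypothesis `hAC` (with `n = 1`) of
`weilQuadratic_re_ge_exp_neg_exp_of_anticlustering` (T68); the existence of such a `Φ` and the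
resulting double-exponential lower law for Weil's functional under RH alone are in
`SoloInformedDoubleLogLaw`.
-/

noncomputable section

open Real Complex MeasureTheory Set Filter Literature.NumberTheory.LFunctions

namespace Summit.RiemannHypothesis.RiemannHypothesis.Theorems

/-- Under RH a jump of `N` on `(T₁, T₂]` is a zero `ζ(1/2 + iγ) = 0` with `T₁ < γ ≤ T₂`. -/
theorem exists_ordinate_of_zetaZeroCount_lt (hRH : _root_.RiemannHypothesis) {T₁ T₂ : ℝ}
    (h : zetaZeroCount T₁ < zetaZeroCount T₂) :
    ∃ γ : ℝ, T₁ < γ ∧ γ ≤ T₂ ∧ riemannZeta (1 / 2 + γ * I) = 0 := by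
  have h2 : zetaOrdinate (zetaZeroCount T₁) ≤ T₂ := lt_zetaZeroCount_iff.1 h
  have h1 : T₁ < zetaOrdinate (zetaZeroCount T₁) := by
    by_contra h1
    push Not at h1
    exact lt_irrefl _ (lt_zetaZeroCount_iff.2 h1)
  obtain ⟨σ, h0, hσ1, hζ⟩ := exists_zero_of_zetaOrdinate_holds (zetaZeroCount T₁)
  refine ⟨zetaOrdinate (zetaZeroCount T₁), h1, h2, ?_⟩
  have hne : (σ : ℂ) + zetaOrdinate (zetaZeroCount T₁) * I ≠ 1 := by
    intro h1'
    have := congrArg Complex.re h1'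
    simp at this
    linarith
  have hre : ((σ : ℂ) + zetaOrdinate (zetaZeroCount T₁) * I).re = 1 / 2 := by
    refine hRH _ hζ ?_ hne
    rintro ⟨k, hk⟩
    have := congrArg Complex.re hk
    simp at this
    linarith [(k.cast_nonneg : (0 : ℝ) ≤ k)]
  have hσ : σ = 1 / 2 := by simpa using hre
  rw [hσ] at hζ
  push_cast at hζ
  exact hζ

/-- Arithmetic of the Riemann–von Mangoldt lower count on a window of length `X ≥ V − 1`. -/
theorem window_count_arith {C L V X : ℝ} (hC : 0 < C) (hL : 48 * π * C + 64 ≤ L) (hLV : L ≤ V)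
    (hX : V - 1 ≤ X) : V * L / (16 * π) ≤ X / (2 * π) * (L - 3) - C * (2 * L + 1) := by
  have hπC : 0 < π * C := by positivity
  have hV : 1 ≤ V := by linarith
  have p1 : 32 * π * C * L ≤ 32 * π * C * V := mul_le_mul_of_nonneg_left hLV (by positivity)
  have p2 : 16 * π * C ≤ 16 * π * C * V := le_mul_of_one_le_right (by positivity) hV
  have p3 : (48 * π * C + 64) * V ≤ L * V := mul_le_mul_of_nonneg_right hL (by linarith)
  have p4 : 0 ≤ π * C * V := mul_nonneg hπC.le (by linarith)
  have p5 : (V - 1) * (L - 3) ≤ X * (L - 3) := mul_le_mul_of_nonneg_right hX (by linarith)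
  have key : V * L + 16 * π * C * (2 * L + 1) ≤ 8 * (X * (L - 3)) := by linarith
  have e : X / (2 * π) * (L - 3) - C * (2 * L + 1) =
      (8 * (X * (L - 3)) - 16 * π * C * (2 * L + 1)) / (16 * π) := by
    field_simp
    ring
  rw [e]
  exact div_le_div_of_nonneg_right (by linarith) (by positivity)

/-- Arithmetic of the right factor of `rigidity_window_moment` for the parameter choice. -/
theorem rigidity_factor_le {X V n E D₁ JΦ L e t Sg : ℝ} (hX0 : 0 ≤ X) (hXV : X ≤ V)
    (hn : n ^ 2 ≤ V) (hE : 0 ≤ E) (hD : 0 ≤ D₁) (hJ : 0 ≤ JΦ) (hL : 1 ≤ L) (ht : 1 ≤ t)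
    (het : e ≤ t) (he : 0 < e) (hlog : Real.log (3 + (t + X)) ≤ L + 4) (hSg0 : 0 ≤ Sg)
    (hSg : Sg ≤ 33 * L ^ 2) :
    3 * X * ((2 * (e * D₁ / t) ^ 2) ^ 2 +
        (E * (Real.log (3 + (t + X)) + 12 + Real.log π) + 1 / (2 * π) * JΦ) ^ 2) +
      12 * (X + 2 * n ^ 2) * (E ^ 2 * Sg) ≤
      (12 * D₁ ^ 4 + 3 * (20 * E + JΦ) ^ 2 + 1188 * E ^ 2 + 1) * V * L ^ 2 := by
  obtain ⟨P₀, hP₀⟩ : ∃ P₀ : ℝ, P₀ = 2 * (e * D₁ / t) ^ 2 := ⟨_, rfl⟩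
  obtain ⟨A₀, hA₀⟩ : ∃ A₀ : ℝ, A₀ = E * (Real.log (3 + (t + X)) + 12 + Real.log π) +
      1 / (2 * π) * JΦ := ⟨_, rfl⟩
  rw [← hP₀, ← hA₀]
  have hV : 0 ≤ V := hX0.trans hXV
  have hP1 : 0 ≤ P₀ := by rw [hP₀]; positivity
  have hP2 : P₀ ≤ 2 * D₁ ^ 2 := by
    have h2 : e * D₁ / t ≤ D₁ := by rw [div_le_iff₀ (by linarith)]; nlinarith
    have h3 : 0 ≤ e * D₁ / t := by positivity
    rw [hP₀]
    nlinarith [pow_le_pow_left₀ h3 h2 2]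
  have hlπ0 : 0 ≤ Real.log π := Real.log_nonneg (by linarith [Real.pi_gt_three])
  have hlπ : Real.log π ≤ 3 := by
    linarith [Real.log_le_sub_one_of_pos Real.pi_pos, Real.pi_lt_four]
  have hl0 : 0 ≤ Real.log (3 + (t + X)) := Real.log_nonneg (by linarith)
  have hA1 : 0 ≤ A₀ := by rw [hA₀]; positivity
  have hA2 : A₀ ≤ (20 * E + JΦ) * L := by
    have h3 : 1 / (2 * π) * JΦ ≤ JΦ := by
      refine mul_le_of_le_one_left hJ ?_
      rw [div_le_one (by positivity)]
      linarith [Real.pi_gt_three]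
    have h4 : E * (Real.log (3 + (t + X)) + 12 + Real.log π) ≤ E * (L + 19) :=
      mul_le_mul_of_nonneg_left (by linarith) hE
    rw [hA₀]
    nlinarith
  have q1 : P₀ ^ 2 ≤ 4 * D₁ ^ 4 := by nlinarith [pow_le_pow_left₀ hP1 hP2 2]
  have q2 : A₀ ^ 2 ≤ (20 * E + JΦ) ^ 2 * L ^ 2 := by
    rw [← mul_pow]; exact pow_le_pow_left₀ hA1 hA2 2
  have q3 : X * (P₀ ^ 2 + A₀ ^ 2) ≤ X * (4 * D₁ ^ 4 + (20 * E + JΦ) ^ 2 * L ^ 2) :=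
    mul_le_mul_of_nonneg_left (add_le_add q1 q2) hX0
  have q4 : X * (4 * D₁ ^ 4 + (20 * E + JΦ) ^ 2 * L ^ 2) ≤
      V * (4 * D₁ ^ 4 + (20 * E + JΦ) ^ 2 * L ^ 2) :=
    mul_le_mul_of_nonneg_right hXV (by positivity)
  have q5 : (X + 2 * n ^ 2) * (E ^ 2 * Sg) ≤ 3 * V * (E ^ 2 * Sg) :=
    mul_le_mul_of_nonneg_right (by linarith) (by positivity)
  have q6 : 3 * V * (E ^ 2 * Sg) ≤ 3 * V * (E ^ 2 * (33 * L ^ 2)) :=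
    mul_le_mul_of_nonneg_left (mul_le_mul_of_nonneg_left hSg (sq_nonneg E)) (by linarith)
  have q7 : 12 * D₁ ^ 4 * V ≤ 12 * D₁ ^ 4 * V * L ^ 2 :=
    le_mul_of_one_le_right (by positivity) (by nlinarith)
  have q8 : 0 ≤ V * L ^ 2 := by positivity
  nlinarith

/-- The cells of one parity class give separated ordinates in the window. -/
theorem separated_ordinates_of_cells {t V b : ℝ} (hb : 0 < b) (hbV : b ≤ V) {J : ℕ}
    (hJ : (J : ℝ) / b ≤ V) {γ : ℕ → ℝ} {O : Finset ℕ} (hOJ : ∀ j ∈ O, j < J)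
    (h1 : ∀ j ∈ O, t + j / b < γ j) (h2 : ∀ j ∈ O, γ j ≤ t + ((j : ℝ) + 1) / b)
    (h3 : ∀ j ∈ O, riemannZeta (1 / 2 + γ j * I) = 0)
    (hsep : ∀ j ∈ O, ∀ j' ∈ O, j ≠ j' → j + 2 ≤ j' ∨ j' + 2 ≤ j) :
    ∃ S : Finset ℝ, (∀ x ∈ S, t ≤ x ∧ x ≤ t + V ∧ riemannZeta (1 / 2 + x * I) = 0) ∧
      (∀ x ∈ S, ∀ y ∈ S, x ≠ y → Real.exp (-V) ≤ |x - y|) ∧ S.card = O.card := by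
  have hb1 : 0 < 1 / b := one_div_pos.2 hb
  have hbe : Real.exp (-V) ≤ 1 / b := by
    rw [Real.exp_neg, ← one_div]
    exact one_div_le_one_div_of_le hb (hbV.trans (by linarith [Real.add_one_le_exp V]))
  have hgap : ∀ j ∈ O, ∀ j' ∈ O, j + 2 ≤ j' → γ j + 1 / b ≤ γ j' := by
    intro j hj j' hj' hjj
    have h4 : ((j : ℝ) + 1) / b + 1 / b ≤ (j' : ℝ) / b := by
      rw [← add_div]
      exact div_le_div_of_nonneg_right (by exact_mod_cast hjj) hb.le
    linarith [h2 j hj, h1 j' hj']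
  refine ⟨O.image γ, fun x hx ↦ ?_, fun x hx y hy hxy ↦ ?_,
    Finset.card_image_of_injOn fun j hj j' hj' hjj ↦ ?_⟩
  · obtain ⟨j, hj, rfl⟩ := Finset.mem_image.1 hx
    have h5 : ((j : ℝ) + 1) / b ≤ J / b :=
      div_le_div_of_nonneg_right (by exact_mod_cast Nat.succ_le_of_lt (hOJ j hj)) hb.le
    have h6 : (0 : ℝ) ≤ j / b := by positivity
    exact ⟨by linarith [h1 j hj], by linarith [h2 j hj], h3 j hj⟩
  · obtain ⟨j, hj, rfl⟩ := Finset.mem_image.1 hx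
    obtain ⟨j', hj', rfl⟩ := Finset.mem_image.1 hy
    rcases hsep j hj j' hj' (fun h ↦ hxy (by rw [h])) with h | h
    · have := hgap j hj j' hj' h
      rw [abs_sub_comm, abs_of_nonneg (by linarith)]
      linarith
    · have := hgap j' hj' j hj h
      rw [abs_of_nonneg (by linarith)]
      linarith
  · by_contra hne
    rcases hsep j (Finset.mem_coe.1 hj) j' (Finset.mem_coe.1 hj') hne with h | h
    · have := hgap j (Finset.mem_coe.1 hj) j' (Finset.mem_coe.1 hj') h
      linarith
    · have := hgap j' (Finset.mem_coe.1 hj') j (Finset.mem_coe.1 hj) h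
      linarith

/-- Two distinct naturals of the same parity differ by at least `2`. -/
theorem two_le_dist_of_parity (Occ O : Finset ℕ) (hO : O = Occ.filter (fun j : ℕ ↦ j % 2 = 0) ∨
    O = Occ.filter (fun j : ℕ ↦ ¬ j % 2 = 0)) :
    ∀ j ∈ O, ∀ j' ∈ O, j ≠ j' → j + 2 ≤ j' ∨ j' + 2 ≤ j := by
  rcases hO with rfl | rfl <;> intro j hj j' hj' hne <;>
    simp only [Finset.mem_filter] at hj hj' <;> omega

/-- `8 ≤ √V` and `√V + 1 ≤ V` for `V ≥ 64`. -/
theorem sqrt_add_one_le {V : ℝ} (hV : 64 ≤ V) : 8 ≤ Real.sqrt V ∧ Real.sqrt V + 1 ≤ V := by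
  have hsqV : Real.sqrt V ^ 2 = V := Real.sq_sqrt (by linarith)
  have hsq8 : 8 ≤ Real.sqrt V := by
    rw [show (8 : ℝ) = Real.sqrt (8 ^ 2) by rw [Real.sqrt_sq (by norm_num)]]
    exact Real.sqrt_le_sqrt (by linarith)
  exact ⟨hsq8, by nlinarith⟩

set_option maxHeartbeats 400000 in
/-- **RH ⟹ (AC*).**  See the module docstring. -/
theorem anticlustering_of_riemannHypothesis (hRH : _root_.RiemannHypothesis) {Φ : ℝ → ℂ}
    (hΦ : IsWeilTest Φ) (ha : tsupport Φ ⊆ Icc (-1) 1) {μ : ℝ} (hμ0 : 0 < μ)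
    (hμ : ∀ u : ℝ, |u| ≤ 2 → μ ≤ ‖weilMellin Φ (1 / 2 + u * I)‖ ^ 2) :
    ∃ c tstar : ℝ, 0 < c ∧ ∀ t V : ℝ, tstar ≤ t → Real.log t ≤ V → V ≤ t →
      ∃ S : Finset ℝ, (∀ γ ∈ S, t ≤ γ ∧ γ ≤ t + V ∧ riemannZeta (1 / 2 + γ * I) = 0) ∧
        (∀ γ ∈ S, ∀ γ' ∈ S, γ ≠ γ' → Real.exp (-V) ≤ |γ - γ'|) ∧
        c * V * Real.log V ≤ S.card := by
  obtain ⟨C, T₁, hC, hT₁, hRvM⟩ := exists_zetaZeroCount_window_ge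
  -- the constants of `Φ`
  obtain ⟨E, hE⟩ : ∃ E : ℝ, E = ∫ x : ℝ, ‖Φ x‖ ^ 2 := ⟨_, rfl⟩
  obtain ⟨D₁, hD₁⟩ : ∃ D₁ : ℝ, D₁ = ∫ x : ℝ, ‖deriv Φ x‖ := ⟨_, rfl⟩
  obtain ⟨JΦ, hJΦ⟩ : ∃ JΦ : ℝ, JΦ =
      ∫ v : ℝ, ‖weilMellin Φ (1 / 2 + v * I)‖ ^ 2 * Real.log (1 + |v|) := ⟨_, rfl⟩
  have hE0 : 0 ≤ E := hE ▸ integral_nonneg fun _ ↦ by positivity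
  have hD0 : 0 ≤ D₁ := hD₁ ▸ integral_nonneg fun _ ↦ norm_nonneg _
  have hJ0 : 0 ≤ JΦ := hJΦ ▸ integral_nonneg fun v ↦
    mul_nonneg (by positivity) (Real.log_nonneg (by linarith [abs_nonneg v]))
  obtain ⟨K₃, hK₃⟩ : ∃ K₃ : ℝ, K₃ = 12 * D₁ ^ 4 + 3 * (20 * E + JΦ) ^ 2 + 1188 * E ^ 2 + 1 :=
    ⟨_, rfl⟩
  have hK₃0 : 0 < K₃ := by rw [hK₃]; positivity
  refine ⟨μ ^ 2 / (2048 * π ^ 2 * K₃), max T₁ (Real.exp (48 * π * C + 64)), by positivity,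
    fun t V ht hVl hVt ↦ ?_⟩
  -- sizes of `t` and `V`
  have htT : T₁ ≤ t := (le_max_left _ _).trans ht
  have hπC : 0 < 48 * π * C := by positivity
  have hlogt : 48 * π * C + 64 ≤ Real.log t := by
    have h := Real.log_le_log (Real.exp_pos _) ((le_max_right _ _).trans ht)
    rwa [Real.log_exp] at h
  have hV64 : 64 ≤ V := by linarith
  have ht1 : 1 ≤ t := by linarith
  have hL1 : 1 ≤ Real.log t := by linarith
  -- the parameters `N`, `b`, `J`
  obtain ⟨N, hN⟩ : ∃ N : ℕ, N = ⌊Real.sqrt V⌋₊ := ⟨_, rfl⟩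
  have hsqV : Real.sqrt V ^ 2 = V := Real.sq_sqrt (by linarith)
  obtain ⟨hsq8, hsq1⟩ := sqrt_add_one_le hV64
  have hNle : (N : ℝ) ≤ Real.sqrt V := by rw [hN]; exact Nat.floor_le (Real.sqrt_nonneg _)
  have hNlt : Real.sqrt V < (N : ℝ) + 1 := by rw [hN]; exact Nat.lt_floor_add_one _
  have hN8 : (8 : ℝ) ≤ (N : ℝ) + 1 := by linarith
  have hN2 : (N : ℝ) ^ 2 ≤ V := by
    rw [← hsqV]; exact pow_le_pow_left₀ (Nat.cast_nonneg N) hNle 2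
  have hNt : (N : ℝ) + 1 ≤ t := by linarith
  obtain ⟨b, hb⟩ : ∃ b : ℝ, b = Real.log ((N : ℝ) + 1) / 2 := ⟨_, rfl⟩
  have hb1 : 1 ≤ b := by
    have h := Real.log_le_log (Real.exp_pos 2)
      (Literature.NumberTheory.Sieve.BrunTwinPrimes.exp_two_le_eight.trans hN8)
    rw [Real.log_exp] at h
    rw [hb]
    linarith
  have hb0 : 0 < b := by linarith
  have hbV : Real.log V / 4 ≤ b := by
    have h1 : Real.log (Real.sqrt V ^ 2) = 2 * Real.log (Real.sqrt V) := by
      rw [Real.log_pow]; push_cast; ring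
    rw [hsqV] at h1
    have h2 : Real.log (Real.sqrt V) ≤ Real.log ((N : ℝ) + 1) :=
      Real.log_le_log (by positivity) hNlt.le
    rw [hb]
    linarith
  have hbt : b ≤ Real.log t := by
    have h := Real.log_le_log (by positivity) hNt
    rw [hb]
    linarith [Real.log_nonneg (by linarith : (1 : ℝ) ≤ (N : ℝ) + 1)]
  have hbVle : b ≤ V := hbt.trans hVl
  have h2b : 2 * (1 * b) = Real.log ((N : ℝ) + 1) := by rw [hb]; ring
  obtain ⟨J, hJ⟩ : ∃ J : ℕ, J = ⌊b * V⌋₊ := ⟨_, rfl⟩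
  have hJle : (J : ℝ) ≤ b * V := by rw [hJ]; exact Nat.floor_le (by positivity)
  have hJlt : b * V < (J : ℝ) + 1 := by rw [hJ]; exact Nat.lt_floor_add_one _
  have hX : (J : ℝ) / b ≤ V := by rw [div_le_iff₀ hb0]; linarith
  have hX' : V - 1 ≤ (J : ℝ) / b := by rw [le_div_iff₀ hb0]; linarith
  have hX0 : (0 : ℝ) ≤ J / b := by positivity
  -- the occupied cells and T72h
  obtain ⟨Occ, hOcc⟩ : ∃ Occ : Finset ℕ, Occ = (Finset.range J).filter (fun j : ℕ ↦
      (zetaZeroCount (t + (j : ℝ) / b) : ℝ) < zetaZeroCount (t + ((j : ℝ) + 1) / b)) :=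
    ⟨_, rfl⟩
  obtain ⟨Sg, hSg⟩ : ∃ Sg : ℝ, Sg =
      ∑ n ∈ Finset.Icc 1 N, ArithmeticFunction.vonMangoldt n ^ 2 / (n : ℝ) := ⟨_, rfl⟩
  have hmom : b * μ ^ 2 * ((zetaZeroCount (t + J / b) : ℝ) - zetaZeroCount t) ^ 2 ≤
      Occ.card * (3 * (J / b) * ((2 * (Real.exp (b / 2) * D₁ / t) ^ 2) ^ 2 +
        (E * (Real.log (3 + (t + J / b)) + 12 + Real.log π) + 1 / (2 * π) * JΦ) ^ 2) +
        12 * (J / b + 2 * (N : ℝ) ^ 2) * (E ^ 2 * Sg)) := by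
    have h := rigidity_window_moment hRH hΦ zero_le_one ha hb1 hμ0.le hμ (N := N)
      (by rw [h2b]) ht1 J
    rw [one_mul] at h
    rw [hOcc, hE, hD₁, hJΦ, hSg]
    exact h
  -- (1) the lower count and (2) the upper bound of the factor
  have hΔ : V * Real.log t / (16 * π) ≤ (zetaZeroCount (t + J / b) : ℝ) - zetaZeroCount t :=
    (window_count_arith hC hlogt hVl hX').trans (hRvM t (J / b) htT hX0 (hX.trans hVt))
  have hΔ0 : 0 ≤ V * Real.log t / (16 * π) := by positivity
  have hSg0 : 0 ≤ Sg := hSg ▸ Finset.sum_nonneg fun n _ ↦ by positivity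
  have hSg1 : Sg ≤ 33 * Real.log t ^ 2 := by
    have h1 : Sg ≤ Real.log N * (22 * Real.log N + 11) := hSg ▸ sum_vonMangoldt_sq_div_le N
    have hl0 : 0 ≤ Real.log N := Real.log_nonneg (by linarith)
    have hlt : Real.log N ≤ Real.log t := Real.log_le_log (by linarith) (by linarith)
    exact h1.trans ((mul_le_mul hlt (by linarith : 22 * Real.log N + 11 ≤ 33 * Real.log t)
      (by linarith) (by linarith)).trans_eq (by ring))
  have het : Real.exp (b / 2) ≤ t := by
    have h1 : Real.exp (b / 2) ≤ Real.exp (Real.log t) := Real.exp_le_exp.2 (by linarith)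
    rwa [Real.exp_log (by linarith)] at h1
  have hlog : Real.log (3 + (t + J / b)) ≤ Real.log t + 4 := by
    have h5 : Real.log 5 ≤ 4 := by
      linarith [Real.log_le_sub_one_of_pos (by norm_num : (0 : ℝ) < 5)]
    have h2 : Real.log (3 + (t + J / b)) ≤ Real.log (5 * t) :=
      Real.log_le_log (by linarith) (by linarith)
    rw [Real.log_mul (by norm_num) (by linarith)] at h2
    linarith
  have hF := rigidity_factor_le hX0 hX hN2 hE0 hD0 hJ0 hL1 ht1 het (Real.exp_pos _) hlog
    hSg0 hSg1
  rw [← hK₃] at hF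
  -- (3) `#Occ ≥ μ² V log V / (1024 π² K₃)`
  have hlogV : 0 ≤ Real.log V := Real.log_nonneg (by linarith)
  have hOccL : μ ^ 2 / (2048 * π ^ 2 * K₃) * V * Real.log V ≤ Occ.card / 2 := by
    have hc0 : (0 : ℝ) ≤ Occ.card := Nat.cast_nonneg _
    have k1 : Real.log V / 4 * μ ^ 2 * (V * Real.log t / (16 * π)) ^ 2 ≤
        b * μ ^ 2 * ((zetaZeroCount (t + J / b) : ℝ) - zetaZeroCount t) ^ 2 :=
      mul_le_mul (mul_le_mul_of_nonneg_right hbV (sq_nonneg μ))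
        (pow_le_pow_left₀ hΔ0 hΔ 2) (by positivity) (by positivity)
    have k2 := (k1.trans hmom).trans (mul_le_mul_of_nonneg_left hF hc0)
    have k3 : μ ^ 2 * V * Real.log V / (1024 * π ^ 2) * (V * Real.log t ^ 2) ≤
        Occ.card * K₃ * (V * Real.log t ^ 2) :=
      calc μ ^ 2 * V * Real.log V / (1024 * π ^ 2) * (V * Real.log t ^ 2)
          = Real.log V / 4 * μ ^ 2 * (V * Real.log t / (16 * π)) ^ 2 := by ring
        _ ≤ _ := k2
        _ = Occ.card * K₃ * (V * Real.log t ^ 2) := by ring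
    have k4 := le_of_mul_le_mul_right k3 (by positivity)
    rw [div_mul_eq_mul_div, div_mul_eq_mul_div, div_le_iff₀ (by positivity)]
    rw [div_le_iff₀ (by positivity)] at k4
    linarith
  -- (4) a zero in every occupied cell; the cells of one parity
  have hzero : ∀ j ∈ Occ, ∃ γ : ℝ, t + j / b < γ ∧ γ ≤ t + ((j : ℝ) + 1) / b ∧
      riemannZeta (1 / 2 + γ * I) = 0 := by
    intro j hj
    rw [hOcc, Finset.mem_filter] at hj
    exact exists_ordinate_of_zetaZeroCount_lt hRH (by exact_mod_cast hj.2)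
  choose! γ hγ1 hγ2 hγ3 using hzero
  have hOJ : ∀ j ∈ Occ, j < J := fun j hj ↦ by
    rw [hOcc, Finset.mem_filter, Finset.mem_range] at hj
    exact hj.1
  have hsplit : (Occ.filter (fun j : ℕ ↦ j % 2 = 0)).card +
      (Occ.filter (fun j : ℕ ↦ ¬ j % 2 = 0)).card = Occ.card :=
    Finset.card_filter_add_card_filter_not _
  have hsel : ∀ O : Finset ℕ, (O = Occ.filter (fun j : ℕ ↦ j % 2 = 0) ∨
      O = Occ.filter (fun j : ℕ ↦ ¬ j % 2 = 0)) → Occ.card ≤ 2 * O.card →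
      ∃ S : Finset ℝ, (∀ γ ∈ S, t ≤ γ ∧ γ ≤ t + V ∧ riemannZeta (1 / 2 + γ * I) = 0) ∧
        (∀ γ ∈ S, ∀ γ' ∈ S, γ ≠ γ' → Real.exp (-V) ≤ |γ - γ'|) ∧
        μ ^ 2 / (2048 * π ^ 2 * K₃) * V * Real.log V ≤ S.card := by
    intro O hO hcard
    have hsub : O ⊆ Occ := by
      rcases hO with rfl | rfl <;> exact Finset.filter_subset _ _
    obtain ⟨S, h1, h2, h3⟩ := separated_ordinates_of_cells hb0 hbVle hX
      (fun j hj ↦ hOJ j (hsub hj)) (fun j hj ↦ hγ1 j (hsub hj)) (fun j hj ↦ hγ2 j (hsub hj))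
      (fun j hj ↦ hγ3 j (hsub hj)) (two_le_dist_of_parity Occ O hO)
    refine ⟨S, h1, h2, ?_⟩
    have h4 : (Occ.card : ℝ) ≤ 2 * S.card := by rw [h3]; exact_mod_cast hcard
    linarith
  rcases le_total (Occ.filter (fun j : ℕ ↦ ¬ j % 2 = 0)).card
    (Occ.filter (fun j : ℕ ↦ j % 2 = 0)).card with hle | hle
  · exact hsel _ (Or.inl rfl) (by omega)
  · exact hsel _ (Or.inr rfl) (by omega)

end Summit.RiemannHypothesis.RiemannHypothesis.Theorems

end
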